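import Summits.PneNP.PneNP.Theorems.NegLimitedNearMarkov
import Summits.PneNP.PneNP.Theorems.NegLimitedBlockParityLanguage

/-!
# Route NegLimited — aside item `NeglimitedEpsLogNegations` (stmt-PneNP-0411) PROVED as typed

The aside item stmt-PneNP-0411 (the route's original, UNGUARDED crux #2: some `L ∈ NP` and
`ε > 0` such that for every `k`, infinitely often, every De Morgan circuit for `L_n` with at most
`⌊ε log₂ n⌋` NOT gates has `> n^k` gates, measured by `negLimitedSizeOver`) holds AS TYPED by the
⊕-fold device of T4 (`NegLimitedNearMarkov.lean`; route-review refuter note of 2026-08-15 on the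
item: "TRUE AS TYPED for an unintended reason"; cell record HOME/pnp-ideate-p3/ROUND-4.md §7.5 and
ERRATUM-P3-F5: `2^{⌊(log₂ n)/2⌋}` blocks). The informative (Monotone-guarded) statement is the
route's crux stmt-PneNP-19860 `NeglimitedEpsLogNegationsR`, untouched here.

* `le_negLimitedSizeOver_blockParity` — the T4 lower-bound engine for the generic block-parity
  language `blockParityLang s F` (`NegLimitedBlockParityLanguage.lean`): if `s(n) = m²`,
  `n / s(n) = 2^R` and `n = 2^R m²`, then every monotone lower bound for
  `(⌊√m⌋-1, ⌊√m⌋)`-clique-like functions is a lower bound for `negLimitedSizeOver deMorganBasis R L_n`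
  (⊕-halving `NegLimitedNearMarkovHalving.lean` + Markov admissibility `decrease_bodd_le`).
* `neglimitedEpsLogNegations` — `ε = 1/2`, block length `s(n) = min (2^{⌊log₂ n⌋/2} - 1) n + 1`,
  designed lengths `n = 2^{32u}`: budget `⌊(1/2) log₂ n⌋ = 16u`, `K = 2^{16u}` blocks of `m²` bits,
  `m = 2^{8u}`, `m^{1/8} = 2^u`, and `2^{c 2^u} > n^k = 2^{32uk}` eventually
  (`Jukna2012_cliqueLike_sqrt_lowerBound_holds`); the item BY NAME:
  `Summit.PneNP.PneNP.Theorems.neglimitedEpsLogNegations_holds`.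

References: S. Jukna, *Boolean Function Complexity* (2012), §10.2, §10.5 Thm. 10.21 / Claim 10.22
(PDF pp. 303–311) [Jukna2012]; É. Tardos, Combinatorica 8 (1988) 141–142 [Tardos1988].
-/

set_option linter.dupNamespace false

noncomputable section

namespace Summit.PneNP.PneNP.Theorems.NegLimNearMarkov

open Finset Literature.Computability.Complexity Literature.Computability.Complexity.GateList
  Literature.Computability.Complexity.Brick Literature.Computability.Complexity.Plumb
  Literature.Barriers.PneNP Summit.PneNP.PneNP.Theorems.NegLimSlices _root_.Computability Filter

/-! ## The lower-bound engine for block-parity languages -/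

/-- **The blocks of a slice input are read by Tardos's function** (generic block length).
[folklore] -/
theorem bp_boolIndicator_block {s : ℕ → ℕ} {F : List Bool → List Bool} (hF : IsThetaApprox F)
    {m K : ℕ} (hm : 1 ≤ m) (hs : s (K * (m * m)) = m * m) (hK : bpBlocks s (K * (m * m)) = K)
    (x : Fin (K * (m * m)) → Bool) (j : Fin K) :
    (witnessLang F).boolIndicator (bpBlock s (List.ofFn x) j) =
      tardosFn (approxOf F m) (Nat.sqrt m) (edgeVec fun q => x (finProdFinEquiv (j, q))) := by
  rw [← sliceFn_witnessLang hF hm, bpBlock_ofFn x (by rw [hK]; exact j.2)]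
  show (witnessLang F).boolIndicator _ = (witnessLang F).boolIndicator _
  congr 1
  apply List.ext_getElem
  · simp [hs]
  · intro i h1 h2
    simp only [List.getElem_ofFn]
    congr 1
    apply Fin.ext
    simp only [finProdFinEquiv_apply_val, hs]
    ring

/-- **The slice of a block-parity language at a designed length is the parity of the accepting
Tardos blocks.** [folklore] -/
theorem bp_sliceFn_eq_bodd_card {s : ℕ → ℕ} {F : List Bool → List Bool} (hF : IsThetaApprox F)
    {m K : ℕ} (hm : 1 ≤ m) (hs : s (K * (m * m)) = m * m) (hK : bpBlocks s (K * (m * m)) = K)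
    (x : Fin (K * (m * m)) → Bool) :
    (blockParityLang s F).sliceFn (K * (m * m)) x =
      Nat.bodd #((univ : Finset (Fin K)).filter fun j =>
        tardosFn (approxOf F m) (Nat.sqrt m) (edgeVec fun q => x (finProdFinEquiv (j, q))) = true) := by
  rw [sliceFn_blockParityLang, hK, card_filter_range_eq_card_filter_univ (P := fun j =>
    (witnessLang F).boolIndicator (bpBlock s (List.ofFn x) j) = true)]
  congr 2
  refine Finset.filter_congr fun j _ => ?_
  rw [bp_boolIndicator_block hF hm hs hK x j]

/-- **The negation-limited lower bound for a block-parity language at a designed length.** If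
`s(n) = m²`, `n / s(n) = 2^R`, `n = 2^R · m²` (`m ≥ 4`) and every monotone circuit for every
`(⌊√m⌋-1, ⌊√m⌋)`-clique-like function has at least `S` gates, then
`S ≤ negLimitedSizeOver deMorganBasis R L_n` for `L = blockParityLang s F` (admissible circuits
exist by Markov, and each is large by ⊕-halving). [cite: Jukna2012, Thm. 10.21 with Claim 10.22 (PDF pp. 310–311)] -/
theorem le_negLimitedSizeOver_blockParity {s : ℕ → ℕ} {F : List Bool → List Bool}
    (hF : IsThetaApprox F) {m R : ℕ} (hm : 4 ≤ m) (hs : s (2 ^ R * (m * m)) = m * m)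
    (hK : bpBlocks s (2 ^ R * (m * m)) = 2 ^ R) {S : ℕ}
    (hlow : ∀ f : (KEdge m → Bool) → Bool,
      CliqueLike (univ : Finset (Fin m)) (Nat.sqrt m - 1) (Nat.sqrt m) f →
      ∀ C : Circuit (KEdge m), C.IsOver monotoneBasis → C.Computes f → S ≤ C.size) :
    S ≤ negLimitedSizeOver deMorganBasis R ((blockParityLang s F).sliceFn (2 ^ R * (m * m))) := by
  set K := 2 ^ R with hKdef
  have hm1 : 1 ≤ m := by omega
  have hk2 : 2 ≤ Nat.sqrt m := Nat.le_sqrt'.2 (by omega)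
  -- Tardos's clique-like block function
  set T := tardosFn (approxOf F m) (Nat.sqrt m) with hT
  have hTcl : CliqueLike (univ : Finset (Fin m)) (Nat.sqrt m - 1) (Nat.sqrt m) T :=
    cliqueLike_tardosFn (by omega) (by omega) _ fun G => approxOf_spec hF hm1 G
  have hT0 : T (fun _ => false) = false := cliqueLike_apply_const hm hTcl false
  have hT1 : T (fun _ => true) = true := cliqueLike_apply_const hm hTcl true
  -- the edges numbered
  set M := Fintype.card (KEdge m) with hM
  let eM : KEdge m ≃ Fin M := Fintype.equivFin (KEdge m)
  let Tfin : (Fin M → Bool) → Bool := fun y => T fun e => y (eM e)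
  have hTfin_mono : Monotone Tfin := fun y y' h => hTcl.mono fun e => h (eM e)
  have hTfin_nc : ∃ x y, Tfin x ≠ Tfin y :=
    ⟨fun _ => false, fun _ => true, by
      show T (fun _ => false) ≠ T (fun _ => true)
      rw [hT0, hT1]; exact Bool.false_ne_true⟩
  -- the slice as a parity of block values
  have hslice := bp_sliceFn_eq_bodd_card hF hm1 hs hK
  -- the retraction onto `Fin K × Fin M`
  have e₀ : KEdge m := ⟨s(⟨0, by omega⟩, ⟨1, by omega⟩), by simp [Fin.ext_iff]⟩
  let e : Fin (K * (m * m)) → Fin K × Fin M := fun p =>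
    ((finProdFinEquiv.symm p).1, eM (edgeOfPos e₀ (finProdFinEquiv.symm p).2))
  refine le_negLimitedSizeOver_of_retract (g := parityFold K M Tfin) e (fun y => ?_) ?_ ?_
  · -- every circuit for the slice, re-wired along `e`, computes the parity fold
    rw [hslice, parityFold_apply]
    congr 2
    refine Finset.filter_congr fun j _ => ?_
    have hblk : (edgeVec fun q => y (e (finProdFinEquiv (j, q)))) = fun e' => y (j, eM e') := by
      simp only [e, Equiv.symm_apply_apply]
      exact edgeVec_comp_edgeOfPos e₀ fun e' => y (j, eM e')
    rw [hblk]
  · -- an admissible circuit exists (Markov)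
    refine exists_circuit_negationCount_le (K := K)
      (N := fun x => #((univ : Finset (Fin K)).filter fun j =>
        T (edgeVec fun q => x (finProdFinEquiv (j, q))) = true))
      (fun x x' hxx' => Finset.card_le_card fun j => ?_) (fun x => ?_) le_rfl hslice ?_
    · simp only [mem_filter, mem_univ, true_and]
      intro hj
      have h := hTcl.mono (show (edgeVec fun q => x (finProdFinEquiv (j, q))) ≤
        edgeVec fun q => x' (finProdFinEquiv (j, q)) from fun _ => hxx' _)
      rw [hj] at h
      exact Bool.eq_true_of_true_le h
    · exact (card_filter_le _ _).trans (by simp [K])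
    · -- not constant: no block accepting vs exactly block `0` accepting
      have hK1 : 0 < K := Nat.two_pow_pos R
      refine ⟨fun _ => false, fun p => decide ((finProdFinEquiv.symm p).1 = ⟨0, hK1⟩), ?_⟩
      rw [hslice, hslice]
      have h0 : ((univ : Finset (Fin K)).filter fun j =>
          T (edgeVec fun q => false) = true) = ∅ := by
        refine Finset.filter_eq_empty_iff.2 fun j _ => ?_
        rw [show (edgeVec fun _ : Fin (m * m) => false) = fun _ => false from rfl, hT0]
        exact Bool.false_ne_true
      have h1 : ((univ : Finset (Fin K)).filter fun j : Fin K =>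
          T (edgeVec fun q => decide ((finProdFinEquiv.symm (finProdFinEquiv (j, q))).1 =
            ⟨0, hK1⟩)) = true) = {⟨0, hK1⟩} := by
        ext j
        simp only [Equiv.symm_apply_apply, mem_filter, mem_univ, true_and, mem_singleton]
        by_cases hj : j = ⟨0, hK1⟩
        · simp only [hj, decide_true]
          rw [show (edgeVec fun _ : Fin (m * m) => true) = fun _ => true from rfl, hT1]
          simp
        · simp only [hj, decide_false]
          rw [show (edgeVec fun _ : Fin (m * m) => false) = fun _ => false from rfl, hT0]
          simp
      rw [h0, h1]
      simp
  · -- every admissible circuit for the parity fold is large (⊕-halving + Alon–Boppana)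
    intro D hDB hDg hDneg
    have h1 : CktSize monotoneBasis (fun (y : Fin M → Bool) (_ : Unit) => Tfin y) D.gates.length :=
      cktSize_of_computes_parityFold hTfin_mono hTfin_nc le_rfl D.gates D.output (wf_gates D) hDB
        D.wf_output (by rw [← circuit_negationCount]; exact hDneg)
        (fun x => by rw [← circuit_eval]; exact hDg x)
    have h2 : CktSize monotoneBasis (fun (z : KEdge m → Bool) (_ : Unit) => T z) D.gates.length :=
      (h1.rewire eM.symm).congr fun z _ => by
        show T _ = T z
        congr 1
        funext e'
        simp
    obtain ⟨C, hCB, hCs, hCf⟩ := h2.toCircuit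
    exact (hlow T hTcl C hCB fun z => hCf z).trans hCs

/-! ## The instance `ε = 1/2`: `2^{⌊log₂ n⌋ / 2}`-bit blocks at the lengths `n = 2^{32u}` -/

/-- The block length of the `ε = 1/2` witness at a designed length:
`min (2^{32u/2} - 1) 2^{32u} + 1 = (2^{8u})²`. [folklore] -/
theorem epsBlockLen_designed (u : ℕ) :
    min (2 ^ (Nat.log 2 (2 ^ (16 * u) * (2 ^ (8 * u) * 2 ^ (8 * u))) / 2) - 1)
        (2 ^ (16 * u) * (2 ^ (8 * u) * 2 ^ (8 * u))) + 1 = 2 ^ (8 * u) * 2 ^ (8 * u) := by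
  have hmm : 2 ^ (8 * u) * 2 ^ (8 * u) = 2 ^ (16 * u) := by rw [← pow_add]; ring_nf
  have hn : 2 ^ (16 * u) * (2 ^ (8 * u) * 2 ^ (8 * u)) = 2 ^ (32 * u) := by
    rw [hmm, ← pow_add]; ring_nf
  rw [hn, hmm, Nat.log_pow one_lt_two, show 32 * u / 2 = 16 * u by omega]
  have h1 : 2 ^ (16 * u) ≤ 2 ^ (32 * u) := Nat.pow_le_pow_right two_pos (by omega)
  have h2 : 1 ≤ 2 ^ (16 * u) := Nat.one_le_two_pow
  rw [min_eq_left (by omega)]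
  omega

/-- The block count of the `ε = 1/2` witness at a designed length: `2^{32u} / 2^{16u} = 2^{16u}`.
[folklore] -/
theorem epsBlocks_designed (u : ℕ) :
    bpBlocks (fun n => min (2 ^ (Nat.log 2 n / 2) - 1) n + 1)
      (2 ^ (16 * u) * (2 ^ (8 * u) * 2 ^ (8 * u))) = 2 ^ (16 * u) := by
  rw [bpBlocks, epsBlockLen_designed]
  have hpos : 0 < 2 ^ (8 * u) * 2 ^ (8 * u) := by positivity
  exact Nat.mul_div_cancel _ hpos

/-- The designed length is `2^{32u}`. [folklore] -/
theorem designed_eq (u : ℕ) : 2 ^ (16 * u) * (2 ^ (8 * u) * 2 ^ (8 * u)) = 2 ^ (32 * u) := by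
  rw [← pow_add, ← pow_add]; ring_nf

/-- The budget `⌊(1/2) log₂ n⌋` at `n = 2^{32u}` is `16u`. [folklore] -/
theorem floor_half_logb_designed (u : ℕ) :
    ⌊(1 / 2 : ℝ) * Real.logb 2 (((2 ^ (32 * u) : ℕ) : ℝ))⌋₊ = 16 * u := by
  rw [Nat.cast_pow, Nat.cast_ofNat, Real.logb_pow, Real.logb_self_eq_one one_lt_two, mul_one,
    show (1 / 2 : ℝ) * ((32 * u : ℕ) : ℝ) = ((16 * u : ℕ) : ℝ) by push_cast; ring, Nat.floor_natCast]

/-- `m^{1/8} = 2^u` for `m = 2^{8u}`. [folklore] -/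
theorem rpow_m8_eq (u : ℕ) : (((2 ^ (8 * u) : ℕ) : ℝ)) ^ (1 / 8 : ℝ) = (2 : ℝ) ^ u := by
  rw [Nat.cast_pow, Nat.cast_ofNat, ← Real.rpow_natCast, ← Real.rpow_mul (by norm_num),
    ← Real.rpow_natCast]
  congr 1
  push_cast
  ring

/-- **Numerics**: `n^k + 1 ≤ 2^{c m^{1/8}}` at `n = 2^{32u}`, `m = 2^{8u}`, as soon as `u ≥ 4` and
`c · u ≥ 32k + 1`. [folklore] -/
theorem pow_succ_le_two_rpow_eps {c : ℝ} (hc : 0 < c) {u k : ℕ} (hu : 4 ≤ u)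
    (huk : (32 * k + 1 : ℝ) ≤ c * u) :
    (((2 ^ (32 * u)) ^ k + 1 : ℕ) : ℝ) ≤
      (2 : ℝ) ^ (c * (((2 ^ (8 * u) : ℕ) : ℝ)) ^ (1 / 8 : ℝ)) := by
  rw [rpow_m8_eq]
  have hur : (4 : ℝ) ≤ u := by exact_mod_cast hu
  -- `n^k + 1 ≤ 2^{32uk+1}`
  have h1 : (((2 ^ (32 * u)) ^ k + 1 : ℕ) : ℝ) ≤ (2 : ℝ) ^ ((32 * u * k + 1 : ℕ) : ℝ) := by
    rw [Real.rpow_natCast]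
    have : (2 ^ (32 * u)) ^ k + 1 ≤ 2 ^ (32 * u * k + 1) := by
      rw [← pow_mul, pow_succ]
      have := Nat.one_le_two_pow (n := 32 * u * k)
      omega
    exact_mod_cast this
  -- `32uk + 1 ≤ c · 2^u`
  have h2 : ((32 * u * k + 1 : ℕ) : ℝ) ≤ c * (2 : ℝ) ^ u := by
    -- `u² ≤ 2^u` for `u ≥ 4` (the tree's `KabanetsCai.sq_le_two_pow`, inlined to keep the import cone)
    have hsqN : ∀ {v : ℕ}, 4 ≤ v → v * v ≤ 2 ^ v := fun {v} hv => by
      induction v, hv using Nat.le_induction with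
      | base => norm_num
      | succ v hv ih =>
        have h2 : (v + 1) * (v + 1) ≤ 2 * (v * v) := by nlinarith
        calc (v + 1) * (v + 1) ≤ 2 * (v * v) := h2
          _ ≤ 2 * 2 ^ v := Nat.mul_le_mul_left 2 ih
          _ = 2 ^ (v + 1) := by rw [pow_succ]; ring
    have hsq : (u : ℝ) * u ≤ (2 : ℝ) ^ u := by exact_mod_cast hsqN hu
    have h3 : ((32 * u * k + 1 : ℕ) : ℝ) ≤ (u : ℝ) * (32 * k + 1) := by push_cast; nlinarith
    have h4 : (u : ℝ) * (32 * k + 1) ≤ c * u * u := by nlinarith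
    nlinarith
  exact h1.trans (Real.rpow_le_rpow_of_exponent_le one_le_two h2)

/-- `m(u) = 2^{8u} → ∞`. [folklore] -/
theorem tendsto_m8_atTop : Tendsto (fun u => 2 ^ (8 * u)) atTop atTop :=
  tendsto_atTop_mono (fun u => ((Nat.le_mul_of_pos_left _ (by norm_num)).trans
    (Nat.lt_two_pow_self).le)) tendsto_id

/-- **stmt-PneNP-0411 (`NegLimited.NeglimitedEpsLogNegations`), verbatim, with `ε = 1/2`.** One
explicit `L ∈ P ⊆ NP` (the block-parity language with `2^{⌊log₂ n⌋/2}`-bit Tardos blocks) whose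
slices at the lengths `n = 2^{32u}` need De Morgan circuits of size `> n^k` under the NOT budget
`⌊(1/2) log₂ n⌋`, for every `k`, infinitely often — true AS TYPED by the ⊕-fold device (the
guarded statement is stmt-PneNP-19860). [cite: Jukna2012, Thm. 10.21 (PDF pp. 310–311)] -/
theorem neglimitedEpsLogNegations :
    ∃ L ∈ Literature.Computability.Complexity.Nondeterministic.NP, ∃ ε : ℝ, 0 < ε ∧ ∀ k : ℕ,
      ∃ᶠ n : ℕ in Filter.atTop, n ^ k <
        Literature.Computability.Complexity.negLimitedSizeOver
          Literature.Computability.Complexity.deMorganBasis ⌊ε * Real.logb 2 n⌋₊ (L.sliceFn n) := by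
  obtain ⟨F, hFP, hspec⟩ := GLS1981_thetaApprox_unary_FP_holds
  have hF : IsThetaApprox F := hspec
  obtain ⟨c, hc, hJ⟩ := Jukna2012_cliqueLike_sqrt_lowerBound_holds
  -- the block-length function and its brick
  let s : ℕ → ℕ := fun n => min (2 ^ (Nat.log 2 n / 2) - 1) n + 1
  let sB : List Bool → List Bool := List.cons true ∘ binToUnaryFn ∘ fanoutFn id (halfFn ∘ logFn)
  have hsB : ∀ w, sB w = ones (s w.length) := fun w => by
    simp only [sB, s, Function.comp_apply, fanoutFn_apply, id, halfFn, length_logFn,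
      binToUnaryFn_boolPair, bitsToNat_ones]
    simp [ones, List.replicate_succ]
  have hsBFP : sB ∈ FP :=
    comp_mem_FP (cons_mem_FP true) (comp_mem_FP binToUnaryFn_mem_FP
      (fanoutFn_mem_FP OracleCompose.id_mem_FP (comp_mem_FP halfFn_mem_FP logFn_mem_FP)))
  refine ⟨blockParityLang s F, blockParityLang_mem_NP hFP hsBFP hsB, 1 / 2, by norm_num,
    fun k => ?_⟩
  -- the bound at every large designed length `n = 2^{32u}`
  have hev : ∀ᶠ u : ℕ in atTop, (2 ^ (32 * u)) ^ k < negLimitedSizeOver deMorganBasis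
      ⌊(1 / 2 : ℝ) * Real.logb 2 (((2 ^ (32 * u) : ℕ) : ℝ))⌋₊
      ((blockParityLang s F).sliceFn (2 ^ (32 * u))) := by
    filter_upwards [eventually_ge_atTop 4, tendsto_m8_atTop.eventually hJ,
      tendsto_m8_atTop.eventually (eventually_ge_atTop 4),
      eventually_ge_atTop (⌈(32 * k + 1 : ℝ) / c⌉₊)] with u h4 hJu hm4 huk
    rw [floor_half_logb_designed]
    apply Nat.lt_of_succ_le
    have hs : s (2 ^ (16 * u) * (2 ^ (8 * u) * 2 ^ (8 * u))) = 2 ^ (8 * u) * 2 ^ (8 * u) :=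
      epsBlockLen_designed u
    have hK := epsBlocks_designed u
    have hmain := le_negLimitedSizeOver_blockParity hF hm4 hs hK (S := (2 ^ (32 * u)) ^ k + 1)
      fun f hf C hCB hCf => by
        have h1 := hJu f hf C hCB hCf
        have huk' : (32 * k + 1 : ℝ) ≤ c * u := by
          have := Nat.ceil_le.1 huk
          rw [div_le_iff₀ hc] at this
          linarith
        have h2 := pow_succ_le_two_rpow_eps hc h4 huk'
        exact_mod_cast h2.trans h1
    rw [designed_eq] at hmain
    exact hmain
  -- infinitely often in `n`
  refine frequently_atTop.2 fun N => ?_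
  obtain ⟨A, hA⟩ := eventually_atTop.1 hev
  refine ⟨2 ^ (32 * max A N), ?_, hA _ (le_max_left _ _)⟩
  exact (le_max_right A N).trans ((Nat.le_mul_of_pos_left _ (by norm_num)).trans
    Nat.lt_two_pow_self.le)

end Summit.PneNP.PneNP.Theorems.NegLimNearMarkov

namespace Summit.PneNP.PneNP.Theorems

/-- **stmt-PneNP-0411 (`NegLimited.NeglimitedEpsLogNegations`, aside) PROVED as typed, by name.**
[cite: Jukna2012, Thm. 10.21 (PDF pp. 310–311)] -/
theorem neglimitedEpsLogNegations_holds :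
    Summit.PneNP.PneNP.Theses.NegLimited.NeglimitedEpsLogNegations :=
  NegLimNearMarkov.neglimitedEpsLogNegations

end Summit.PneNP.PneNP.Theorems

end
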